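import Literature.AlgebraicGeometry.Frobenioids.Thm42SubII
import Literature.AlgebraicGeometry.Frobenioids.Thm49FunctorialPullbacks
import Literature.AlgebraicGeometry.Frobenioids.CoprimarySteps
import HarnessLib

/-!
# [FrdI] Theorem 4.2, proof step T42-L11b: compatibility of `Ψ^Prime` with `Prime(Φ_i(−))` along
# PULL-BACK morphisms ("pulling back primary steps", Prop. 1.11 (v)) — proofs

Mochizuki, *The geometry of Frobenioids I: the general theory*, Kyushu J. Math. **62** (2008)
293–400, §4, proof of Theorem 4.2 (i), kurims text p. 81 ll. 5–31 [cite: MochizukiFrdI2008, Thm. 4.2 (i) p.81]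
(render `paper:url-bbf705efa10f`): in the characterisation of Div-identity endomorphisms `α = β ∘ γ`,
"`β′` is a pull-back morphism [cf. Proposition 1.11, (v)]" — the primary step `A′ → A` is PULLED BACK
along the pull-back morphism, and its zero divisor is carried by `Base(−)^*` to the zero divisor of the
pulled-back primary step; Prop. 1.11 (v), kurims p. 37–38: "if `φ : A → B` is … `α : C → A` and
`β : D → B` … co-angular pre-steps such that `(α_*)⁻¹(Div(α)) = φ^*{(β_*)⁻¹(Div(β))}` … then there exists
a unique morphism `ψ : C → D` in `C^lin` such that `β ∘ ψ = φ ∘ α` … Moreover, `φ` is a pull-back morphism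
if and only if `ψ` is."

PROOF-ONLY companion of `Thm42SubII.lean` (abc-iut-L1-t14; sub-DAG `plan/L1/SUBDAG-FrdI-Thm42-Thm49.md`,
row **T42-L11b `PrimesCompatibleAlongPullback`** = the pull-back-morphism case of the compatibility square
`FrdI.T42.PrimesCompatibleAlong` that rows L09/L10 assert for morphisms of Frobenius type / pre-steps;
hand-back of abc-iut-w4-d068, 2026-08-26T00:36:50Z, whose L11a = `DivIdentityPrimeRays.lean`).
Nothing is defined or asserted; hypotheses are the tree's Def. 1.3 notions and `FrdI.T42.Setting`.

What is proved (sorry-free):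

* `PreFrobenioid.invDiv_eq_pull_invDiv_of_pullback_square` — in a Frobenioid, a commutative square
  `ψ ≫ β = α ≫ φ` whose sides `φ`, `ψ` are pull-back morphisms and whose sides `α`, `β` are base-isomorphisms
  satisfies `(α_*)⁻¹ Div α = Base(φ)^* (β_*)⁻¹ Div β` (divisor bookkeeping of "pulling back a pre-step",
  from abc-iut's `div_eq_pull_div_of_pullback_square`).
* `PreFrobenioid.primes_compatible_of_isPullbackMorphism` — **T42-L11b, functor form**: let
  `G : C₁ → C₂` be a functor between Frobenioids preserving pre-steps and pull-back morphisms
  [Thm. 3.4 (ii)(iii)], and `e_A : Prime(Φ₁(A)) ≃ Prime(Φ₂(G A))` ANY family carrying, for every PRIMARY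
  pre-step `ε : E → A` with `(ε_*)⁻¹ Div ε ∈ 𝔭`, the element `((Gε)_*)⁻¹ Div(Gε)` into `e_A 𝔭` (the defining
  clause of `Ψ^Prime`, row L08). Then for every pull-back morphism `φ : A → A'` and primes `𝔭 ⊆ Φ₁(A)`,
  `𝔭' ⊆ Φ₁(A')` that correspond under `Base(φ)^*` (some primary `p' ∈ 𝔭'` has `Base(φ)^* p' ∈ 𝔭`), the primes
  `e_A 𝔭`, `e_{A'} 𝔭'` correspond under `Base(G φ)^*`. Proof = the printed one: realise `p'` and `Base(φ)^* p'`
  as `(β_*)⁻¹ Div β`, `(α_*)⁻¹ Div α` of co-angular (hence primary) pre-steps INTO `A'`, `A`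
  (Def. 1.3 (iii)(d), slice), complete to a square `ψ ≫ β = α ≫ φ` with `ψ` a pull-back morphism
  (Prop. 1.11 (v), slice case: `PreFrobenioid.exists_pullback_square_over`), map the square by `G` and read
  off `((Gα)_*)⁻¹ Div(Gα) = Base(Gφ)^* ((Gβ)_*)⁻¹ Div(Gβ)` in `C₂`.
* `FrdI.T42.primesCompatibleAlong_of_isPullbackMorphism` — the same in the exact binders of rows
  L09/L10 of `Thm42SubII.lean` (a `T42.Setting F₁ F₂ Ψ`, the family `e` with its L08 clause):
  `IsPullbackMorphism F₁ γ → PrimesCompatibleAlong F₁ F₂ Ψ e γ`.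

No statement of the paper is strengthened; the hypotheses are implied by `T42.Setting.preStep_map`,
`T42.Setting.pullback_map` and the clause of row L08.
-/

namespace Literature.AlgebraicGeometry.Frobenioids

open CategoryTheory Opposite

universe w v v' u u'

namespace PreFrobenioid

section OneFrobenioid

variable {D : Type u} [Category.{v} D] {Φ : Dᵒᵖ ⥤ CommMonCat.{w}}
  {C : Type u'} [Category.{v'} C] {F : C ⥤ ElemFrobenioid Φ}

/-- **Zero divisors in a pulled-back pre-step square.** In a Frobenioid, if `ψ ≫ β = α ≫ φ` with `φ`, `ψ`
pull-back morphisms and `α`, `β` base-isomorphisms, then `(α_*)⁻¹ Div α = Base(φ)^* ((β_*)⁻¹ Div β)`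
(Rem. 1.1.1 + Def. 1.3 (iv)(b), through `div_eq_pull_div_of_pullback_square`).
[cite: MochizukiFrdI2008, Prop. 1.11(v) p.38] -/
theorem invDiv_eq_pull_invDiv_of_pullback_square (hF : IsFrobenioid F) {X B A A' : C} {α : X ⟶ A}
    {ψ : X ⟶ B} {φ : A ⟶ A'} {β : B ⟶ A'} (hφ : IsPullbackMorphism F φ) (hψ : IsPullbackMorphism F ψ)
    (hα : IsBaseIso F α) (hβ : IsBaseIso F β) (h : ψ ≫ β = α ≫ φ) :
    invDiv F α hα = pull Φ (Base F φ) (invDiv F β hβ) := by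
  haveI : IsIso (Base F α) := hα
  haveI : IsIso (Base F β) := hβ
  -- `Div α = Base(ψ)^* Div β`
  have hdiv : Div F α = pull Φ (Base F ψ) (Div F β) := div_eq_pull_div_of_pullback_square hF hψ hφ h.symm
  apply pull_injective_of_isIso Φ (Base F α)
  rw [pull_invDiv, ← pull_comp, ← base_comp, ← h, base_comp, pull_comp, pull_invDiv, hdiv]

end OneFrobenioid

section TwoFrobenioids

variable {D₁ : Type u} [Category.{v} D₁] {Φ₁ : D₁ᵒᵖ ⥤ CommMonCat.{w}} {C₁ : Type u'}
  [Category.{v'} C₁] {D₂ : Type u} [Category.{v} D₂] {Φ₂ : D₂ᵒᵖ ⥤ CommMonCat.{w}} {C₂ : Type u'}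
  [Category.{v'} C₂] {F₁ : C₁ ⥤ ElemFrobenioid Φ₁} {F₂ : C₂ ⥤ ElemFrobenioid Φ₂}

/-- **[FrdI] Thm. 4.2, step T42-L11b ("pulling back primary steps", Prop. 1.11 (v)), functor form.**
Let `G : C₁ → C₂` be a functor between Frobenioids preserving pre-steps and pull-back morphisms
[Thm. 3.4 (ii)(iii)], and `e_A : Prime(Φ₁(A)) ≃ Prime(Φ₂(G A))` a family such that for every primary
pre-step `ε : E → A` with `(ε_*)⁻¹ Div ε ∈ 𝔭` one has `((Gε)_*)⁻¹ Div(Gε) ∈ e_A 𝔭` (the clause defining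
`Ψ^Prime`, row L08). Then for every PULL-BACK morphism `φ : A → A'`, primes `𝔭 ⊆ Φ₁(A)`, `𝔭' ⊆ Φ₁(A')`
with `Base(φ)^* p' ∈ 𝔭` for some `p' ∈ 𝔭'` are carried by `e` to primes with `Base(Gφ)^* q' ∈ e_A 𝔭` for
some `q' ∈ e_{A'} 𝔭'`. [cite: MochizukiFrdI2008, Thm. 4.2 (i) p.81] -/
theorem primes_compatible_of_isPullbackMorphism (hF₁ : IsFrobenioid F₁) (hF₂ : IsFrobenioid F₂)
    (G : C₁ ⥤ C₂)
    (hGps : ∀ ⦃X Y : C₁⦄ (φ : X ⟶ Y), IsPreStep F₁ φ → IsPreStep F₂ (G.map φ))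
    (hGpb : ∀ ⦃X Y : C₁⦄ (φ : X ⟶ Y), IsPullbackMorphism F₁ φ → IsPullbackMorphism F₂ (G.map φ))
    (e : ∀ A : C₁, Primes (Φ₁.obj (op (baseObj F₁ A))) ≃ Primes (Φ₂.obj (op (baseObj F₂ (G.obj A)))))
    (he : ∀ (A : C₁) ⦃E : C₁⦄ (ε : E ⟶ A) (hε : IsPrimaryPreStep F₁ ε)
      (𝔭 : Primes (Φ₁.obj (op (baseObj F₁ A)))), invDiv F₁ ε hε.1.2 ∈ 𝔭.carrier →
        ∀ h₂ : IsBaseIso F₂ (G.map ε), invDiv F₂ (G.map ε) h₂ ∈ (e A 𝔭).carrier)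
    ⦃A A' : C₁⦄ (φ : A ⟶ A') (hφ : IsPullbackMorphism F₁ φ)
    (𝔭 : Primes (Φ₁.obj (op (baseObj F₁ A)))) (𝔭' : Primes (Φ₁.obj (op (baseObj F₁ A'))))
    (h𝔭 : ∃ p' ∈ 𝔭'.carrier, pull Φ₁ (Base F₁ φ) p' ∈ 𝔭.carrier) :
    ∃ q' ∈ (e A' 𝔭').carrier, pull Φ₂ (Base F₂ (G.map φ)) q' ∈ (e A 𝔭).carrier := by
  obtain ⟨p', hp', hp⟩ := h𝔭
  have hp'prim : IsPrimary p' := hp'.fst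
  have hpprim : IsPrimary (pull Φ₁ (Base F₁ φ) p') := hp.fst
  -- co-angular pre-steps INTO `A'`, `A` with prescribed `(−_*)⁻¹ Div` (Def. 1.3 (iii)(d), slice)
  obtain ⟨B, β, hβco, hβx⟩ := hF₁.iii_d_over_surj A' p'
  obtain ⟨X, α, hαco, hαx⟩ := hF₁.iii_d_over_surj A (pull Φ₁ (Base F₁ φ) p')
  haveI : IsIso (Base F₁ β) := hβco.2.2
  haveI : IsIso (Base F₁ α) := hαco.2.2
  -- they are primary pre-steps
  have hβprim : IsPrimaryPreStep F₁ β :=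
    ⟨hβco.2, by rw [← pull_invDiv β hβco.2.2, hβx]; exact (isPrimary_pull_iff _ _).mpr hp'prim⟩
  have hαprim : IsPrimaryPreStep F₁ α :=
    ⟨hαco.2, by rw [← pull_invDiv α hαco.2.2, hαx]; exact (isPrimary_pull_iff _ _).mpr hpprim⟩
  -- "pulling back pre-steps" (Prop. 1.11 (v), slice case): `ψ ≫ β = α ≫ φ`, `ψ` a pull-back morphism
  obtain ⟨ψ, hψ, hsq⟩ := exists_pullback_square_over hF₁ hφ α β hαco hβco (by rw [hαx, hβx])
  -- the images under `G`
  have h₂β : IsBaseIso F₂ (G.map β) := (hGps β hβco.2).2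
  have h₂α : IsBaseIso F₂ (G.map α) := (hGps α hαco.2).2
  have hqβ : invDiv F₂ (G.map β) h₂β ∈ (e A' 𝔭').carrier :=
    he A' β hβprim 𝔭' (by rw [show invDiv F₁ β hβprim.1.2 = p' from hβx]; exact hp') h₂β
  have hqα : invDiv F₂ (G.map α) h₂α ∈ (e A 𝔭).carrier :=
    he A α hαprim 𝔭 (by rw [show invDiv F₁ α hαprim.1.2 = _ from hαx]; exact hp) h₂α
  have hsq₂ : G.map ψ ≫ G.map β = G.map α ≫ G.map φ := by rw [← G.map_comp, hsq, G.map_comp]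
  refine ⟨invDiv F₂ (G.map β) h₂β, hqβ, ?_⟩
  rw [← invDiv_eq_pull_invDiv_of_pullback_square hF₂ (hGpb φ hφ) (hGpb ψ hψ) h₂α h₂β hsq₂]
  exact hqα

end TwoFrobenioids

end PreFrobenioid

/-! ## In the binders of `Thm42SubII.lean` (rows L09/L10): the pull-back case of `PrimesCompatibleAlong` -/

namespace FrdI.T42

variable {D₁ : Type u} [Category.{v} D₁] {Φ₁ : D₁ᵒᵖ ⥤ CommMonCat.{w}} {C₁ : Type u'} [Category.{v'} C₁]
  {D₂ : Type u} [Category.{v} D₂] {Φ₂ : D₂ᵒᵖ ⥤ CommMonCat.{w}} {C₂ : Type u'} [Category.{v'} C₂]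
  {F₁ : C₁ ⥤ ElemFrobenioid Φ₁} {F₂ : C₂ ⥤ ElemFrobenioid Φ₂} {Ψ : C₁ ≌ C₂}

/-- **T42-L11b `PrimesCompatibleAlongPullback`** ([FrdI] Thm. 4.2 (i), p. 81 l. 20–27: "`β′` is a pull-back
morphism [cf. Proposition 1.11, (v)]"): in the setting of Thm. 4.2, every family `e = Ψ^Prime` with the clause
of row L08 is compatible with `Prime(Φ₁(−))`, `Prime(Φ₂(−))` along every PULL-BACK morphism `γ` of `C₁` —
the pull-back companion of rows L09 (`PsiPrimeFunctorialFrobeniusType`) and L10 (`PsiPrimeFunctorialPreStep`).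
[cite: MochizukiFrdI2008, Thm. 4.2 (i) p.81] -/
theorem primesCompatibleAlong_of_isPullbackMorphism (S : Setting F₁ F₂ Ψ)
    (e : ∀ A : C₁, Primes (Φ₁.obj (op (PreFrobenioid.baseObj F₁ A))) ≃
      Primes (Φ₂.obj (op (PreFrobenioid.baseObj F₂ (Ψ.functor.obj A)))))
    (he : ∀ (A : C₁) ⦃E : C₁⦄ (ε : E ⟶ A) (hε : PreFrobenioid.IsPrimaryPreStep F₁ ε)
      (𝔭 : Primes (Φ₁.obj (op (PreFrobenioid.baseObj F₁ A)))),
      PreFrobenioid.invDiv F₁ ε hε.1.2 ∈ 𝔭.carrier →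
        ∀ h₂ : PreFrobenioid.IsBaseIso F₂ (Ψ.functor.map ε),
          PreFrobenioid.invDiv F₂ (Ψ.functor.map ε) h₂ ∈ (e A 𝔭).carrier)
    {A A' : C₁} (γ : A ⟶ A') (hγ : PreFrobenioid.IsPullbackMorphism F₁ γ) :
    PrimesCompatibleAlong F₁ F₂ Ψ e γ :=
  fun 𝔭 𝔭' h𝔭 =>
    PreFrobenioid.primes_compatible_of_isPullbackMorphism S.isFrobenioid₁ S.isFrobenioid₂ Ψ.functor
      S.preStep_map S.pullback_map e he γ hγ 𝔭 𝔭' h𝔭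

end FrdI.T42

end Literature.AlgebraicGeometry.Frobenioids
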